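import Literature.Analysis.FluidPDE.ParabolicHeatPotentials
import HarnessLib

/-!
# The forward heat potential of `(∂ₜ - νΔ)Φ` is `Φ` for space–time test fields

Analysis/FluidPDE support file (everything proved) in the decomposition of the named fact
`Literature.Analysis.FluidPDE.LemarieRieusset2016.lemma13_6_duhamel` (`CKNMorreyHolder.lean`:
Lemarié-Rieusset 2016, §13.9 Step 3 and the proof of Lemma 13.6, pp. 474–478 — the localised
velocity `φu` is the Duhamel integral of the data of its equation). In the tree's discharge of
that fact the terms of the Duhamel representation whose data live away from the cylinder of
interest are smooth there, and are re-expanded as heat potentials of smooth compactly supported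
data through the identity proved here:

* `IsSpaceTimeTestOn.heatPotential_heatOperator` — for a space–time test field `Φ` on `ℝ × E`
  (values in a real Banach space) and `ν > 0`,
  `heatPotential ν ((∂ₜ - νΔ)Φ) = Φ`, i.e. `∫∫ W₊(z - w) (∂ₜΦ - νΔΦ)(w) dw = Φ(z)` with the
  accepted forward space–time heat kernel `W₊ = heatKernelFwd ν` and heat potential
  `heatPotential` (`ParabolicHeatPotentials.lean`).

This is Duhamel's formula for the (forward) heat equation read backwards: a smooth compactly
supported `Φ` is the solution, vanishing in the far past, of `∂ₜv - νΔv = (∂ₜ - νΔ)Φ`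
(Evans, *PDE*, §2.3.1 Thm. 2; Lemarié-Rieusset 2016, Prop. 4.3, p. 74, after time reversal).
It is obtained from the accepted **backward** identity
`𝒰[∂ₜΘ] + ν 𝒰[ΔΘ] = -Θ` for the backward caloric Duhamel integral `𝒰 = heatDuhamelBack ν`
(`IsSpaceTimeTestOn.heatDuhamelBack_backward_heat`, `HeatDuhamelBack.lean`) by the time
reflection `Θ(s) = Φ(-s)`:

* `IsSpaceTimeTestOn.timeReflect` — `(s, y) ↦ Φ(-s, y)` is again a space–time test field, with
  `∂ₜ(Φ(-·))(s) = -(∂ₜΦ)(-s)` (`timeDeriv_timeReflect`);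
* `IsSpaceTimeTestOn.heatPotential_timeReflect` — **forward potentials are reflected backward
  Duhamel integrals**: `heatPotential ν (Ψ(-·, ·)) (t, x) = 𝒰[Ψ](-t)(x)` (the accepted
  convolution form `𝒰[Ψ] = heatDuhamelKernel ν ⋆ uncurry Ψ` of `HeatDuhamelSmooth.lean`, the
  relation `heatKernelFwd ν (τ, y) = heatDuhamelKernel ν (-τ, y)`, and the measure-preserving
  substitution `w ↦ (t + w.1, x - w.2)` of `ℝ × E`), together with the integrability of the
  forward integrand (`integrable_heatKernelFwd_smul_timeReflect`);
* linearity of `heatPotential` in integrable data (`heatPotential_add`, `heatPotential_neg`,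
  `heatPotential_smul`).

## Mathlib / tree search

Tree (all used): `heatPotential`, `heatKernelFwd`, `heatKernelFwd_eq_heatDuhamelKernel`
(`ParabolicHeatPotentials`); `heatDuhamelBack`, `IsSpaceTimeTestOn.heatDuhamelBack_backward_heat`,
`.timeDeriv_top`, `.laplacian_top` (`HeatDuhamelBack`); `IsSpaceTimeTestOn.heatDuhamelBack_eq_convolution`,
`.integrable_heatDuhamelKernel_smul` (`HeatDuhamelSmooth`); `isAddLeftInvariant_volume_real_prod`,
`isNegInvariant_volume_real_prod` (`CaloricPotentialContinuity`). Mathlib: `deriv_comp_neg`,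
`MeasurePreserving.prod`, `measurePreserving_add_left`, `Measure.measurePreserving_sub_left`,
`MeasurableEquiv.prodCongr` / `.addLeft` / `.subLeft`, `MeasurePreserving.integral_comp'`, `MeasurePreserving.integrable_comp_emb`. No forward Duhamel
representation of test functions was found in the tree (`lean search 'heatPotential'`: only
`ParabolicHeatPotentials`, `CKNMorreyHolder`).

## References

* L. C. Evans, *Partial Differential Equations*, 2nd ed. (AMS 2010), §2.3.1, Thm. 2 (solution of
  the nonhomogeneous heat problem by Duhamel's principle).
* P. G. Lemarié-Rieusset, *The Navier–Stokes Problem in the 21st Century*, CRC Press (2016),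
  Prop. 4.3 p. 74; §13.9 Step 3, (13.50)–(13.52), pp. 474–475. [LemarieRieusset2016]
-/

noncomputable section

open MeasureTheory Set Function Filter Topology TopologicalSpace ContinuousLinearMap
open scoped Laplacian

namespace Literature.Analysis.FluidPDE

variable {E : Type*} [NormedAddCommGroup E] [InnerProductSpace ℝ E] [FiniteDimensional ℝ E]
  [MeasurableSpace E] [BorelSpace E]
variable {F : Type*} [NormedAddCommGroup F] [NormedSpace ℝ F]

/-! ### Time reflection of space–time test fields -/

section Reflect

omit [MeasurableSpace E] [BorelSpace E] [FiniteDimensional ℝ E] in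
/-- **Time reflection preserves space–time test fields**: if `Φ` is a space–time test field on
`ℝ × E`, so is `(s, y) ↦ Φ(-s, y)` (composition with the linear homeomorphism
`(s, y) ↦ (-s, y)`). [folklore] -/
theorem IsSpaceTimeTestOn.timeReflect {Φ : ℝ → E → F}
    (hΦ : IsSpaceTimeTestOn (⊤ : Opens (ℝ × E)) Φ) :
    IsSpaceTimeTestOn (⊤ : Opens (ℝ × E)) (fun s y => Φ (-s) y) where
  contDiff := by
    have h1 : ContDiff ℝ (⊤ : ℕ∞) fun p : ℝ × E => ((-p.1, p.2) : ℝ × E) :=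
      (contDiff_neg.comp contDiff_fst).prodMk contDiff_snd
    have h2 : uncurry (fun s y => Φ (-s) y) = uncurry Φ ∘ fun p : ℝ × E => ((-p.1, p.2) : ℝ × E) := by
      funext p; rfl
    rw [h2]
    exact hΦ.contDiff.comp h1
  hasCompactSupport := by
    set e : ℝ × E ≃ₜ ℝ × E := (Homeomorph.neg ℝ).prodCongr (Homeomorph.refl E) with he
    have h2 : uncurry (fun s y => Φ (-s) y) = uncurry Φ ∘ e := by
      funext p; rfl
    rw [h2]
    exact hΦ.hasCompactSupport.comp_homeomorph e
  tsupport_subset := fun _ _ => trivial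

omit [NormedAddCommGroup E] [InnerProductSpace ℝ E] [FiniteDimensional ℝ E] [MeasurableSpace E]
  [BorelSpace E] in
/-- The time derivative of the reflected field: `∂ₜ(Φ(-·, y))(s) = -(∂ₜΦ)(-s, y)`. [folklore] -/
theorem timeDeriv_timeReflect (Φ : ℝ → E → F) (s : ℝ) (y : E) :
    timeDeriv (fun s y => Φ (-s) y) s y = -timeDeriv Φ (-s) y := by
  simp only [timeDeriv]
  exact deriv_comp_neg (f := fun r => Φ r y) (x := s)

end Reflect

/-! ### Linearity of the heat potential -/

section Linear

variable {ν : ℝ}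

/-- The heat potential of a sum of data with integrable integrands is the sum of the heat
potentials. [folklore] -/
theorem heatPotential_add {F₁ F₂ : ℝ × E → F} {z : ℝ × E}
    (h₁ : Integrable (fun w => heatKernelFwd ν (z - w) • F₁ w) (volume : Measure (ℝ × E)))
    (h₂ : Integrable (fun w => heatKernelFwd ν (z - w) • F₂ w) (volume : Measure (ℝ × E))) :
    heatPotential ν (fun w => F₁ w + F₂ w) z = heatPotential ν F₁ z + heatPotential ν F₂ z := by
  simp only [heatPotential, smul_add]
  exact integral_add h₁ h₂

/-- The heat potential of `-F` is minus the heat potential of `F`. [folklore] -/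
theorem heatPotential_neg (F₁ : ℝ × E → F) (z : ℝ × E) :
    heatPotential ν (fun w => -F₁ w) z = -heatPotential ν F₁ z := by
  simp only [heatPotential, smul_neg]
  exact integral_neg _

/-- The heat potential of `c • F` is `c •` the heat potential of `F`. [folklore] -/
theorem heatPotential_smul (c : ℝ) (F₁ : ℝ × E → F) (z : ℝ × E) :
    heatPotential ν (fun w => c • F₁ w) z = c • heatPotential ν F₁ z := by
  simp only [heatPotential, smul_comm _ c]
  exact integral_smul c _

end Linear

/-! ### Forward potentials of reflected test fields are backward Duhamel integrals -/

section ReflectPotential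

variable {ν : ℝ} {Ψ : ℝ → E → F}

omit [InnerProductSpace ℝ E] [FiniteDimensional ℝ E] in
/-- The substitution `w ↦ (t + w.1, x - w.2)` of `ℝ × E`, realised by the measurable equivalence
`(MeasurableEquiv.addLeft t).prodCongr (MeasurableEquiv.subLeft x)`. [folklore] -/
theorem addLeft_prodCongr_subLeft_apply (t : ℝ) (x : E) (w : ℝ × E) :
    ((MeasurableEquiv.addLeft t).prodCongr (MeasurableEquiv.subLeft x) : ℝ × E ≃ᵐ ℝ × E) w =
      (t + w.1, x - w.2) := rfl

/-- The substitution `w ↦ (t + w.1, x - w.2)` of `ℝ × E` is measure preserving. [folklore] -/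
theorem measurePreserving_addLeft_prodCongr_subLeft (t : ℝ) (x : E) :
    MeasurePreserving ((MeasurableEquiv.addLeft t).prodCongr (MeasurableEquiv.subLeft x) :
        ℝ × E ≃ᵐ ℝ × E) (volume : Measure (ℝ × E)) (volume : Measure (ℝ × E)) := by
  have h1 : MeasurePreserving (MeasurableEquiv.addLeft t) (volume : Measure ℝ) volume :=
    measurePreserving_add_left volume t
  have h2 : MeasurePreserving (MeasurableEquiv.subLeft x) (volume : Measure E) volume :=
    Measure.measurePreserving_sub_left volume x
  have h := h1.prod h2
  rw [Measure.volume_eq_prod]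
  exact h

omit [FiniteDimensional ℝ E] [MeasurableSpace E] [BorelSpace E] in
/-- After the substitution `w ↦ (t + w.1, x - w.2)` the forward integrand of the reflected field
is the backward convolution integrand: `W₊((t,x) - (t + σ, x - y)) • Ψ(-(t + σ), x - y) =
k(σ, y) • Ψ̃((-t, x) - (σ, y))`. [folklore] -/
theorem heatKernelFwd_smul_timeReflect_comp (t : ℝ) (x : E) (w : ℝ × E) :
    heatKernelFwd ν ((t, x) - (t + w.1, x - w.2)) • Ψ (-(t + w.1)) (x - w.2) =
      heatDuhamelKernel ν w • uncurry Ψ (((-t, x) : ℝ × E) - w) := by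
  have h1 : ((t, x) : ℝ × E) - (t + w.1, x - w.2) = (-w.1, w.2) := by
    ext <;> simp
  have h2 : heatKernelFwd ν ((-w.1, w.2) : ℝ × E) = heatDuhamelKernel ν w := by
    rw [heatKernelFwd_eq_heatDuhamelKernel, neg_neg]
  rw [h1, h2]
  congr 1
  simp only [uncurry, Prod.fst_sub, Prod.snd_sub, neg_add_rev]
  congr 1
  ring

/-- **The forward integrand of a reflected test field is integrable**:
`w ↦ W₊((t,x) - w) • Ψ(-w.1, w.2)` is integrable on `ℝ × E` for a space–time test field `Ψ`
and `ν > 0`. [folklore] -/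
theorem IsSpaceTimeTestOn.integrable_heatKernelFwd_smul_timeReflect
    (hΨ : IsSpaceTimeTestOn (⊤ : Opens (ℝ × E)) Ψ) (hν : 0 < ν) (t : ℝ) (x : E) :
    Integrable (fun w : ℝ × E => heatKernelFwd ν ((t, x) - w) • Ψ (-w.1) w.2)
      (volume : Measure (ℝ × E)) := by
  have h := hΨ.integrable_heatDuhamelKernel_smul hν (-t) x
  have hmp := measurePreserving_addLeft_prodCongr_subLeft (E := E) t x
  have heq : (fun w : ℝ × E => heatDuhamelKernel ν w • uncurry Ψ (((-t, x) : ℝ × E) - w)) =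
      (fun w : ℝ × E => heatKernelFwd ν ((t, x) - w) • Ψ (-w.1) w.2) ∘
        ((MeasurableEquiv.addLeft t).prodCongr (MeasurableEquiv.subLeft x) : ℝ × E ≃ᵐ ℝ × E) := by
    funext w
    rw [Function.comp_apply, addLeft_prodCongr_subLeft_apply]
    exact (heatKernelFwd_smul_timeReflect_comp (ν := ν) (Ψ := Ψ) t x w).symm
  rw [heq] at h
  exact (hmp.integrable_comp_emb (MeasurableEquiv.measurableEmbedding _)).1 h

/-- **Forward potentials of reflected test fields are backward Duhamel integrals**:
`heatPotential ν ((s,y) ↦ Ψ(-s, y)) (t, x) = 𝒰[Ψ](-t)(x)` for a space–time test field `Ψ` and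
`ν > 0` (`𝒰 = heatDuhamelBack ν`; via `𝒰[Ψ] = heatDuhamelKernel ν ⋆ uncurry Ψ` and the
substitution `w ↦ (t + w.1, x - w.2)`). [folklore] -/
theorem IsSpaceTimeTestOn.heatPotential_timeReflect [CompleteSpace F]
    (hΨ : IsSpaceTimeTestOn (⊤ : Opens (ℝ × E)) Ψ) (hν : 0 < ν) (t : ℝ) (x : E) :
    heatPotential ν (fun w => Ψ (-w.1) w.2) (t, x) = heatDuhamelBack ν Ψ (-t) x := by
  rw [hΨ.heatDuhamelBack_eq_convolution hν (-t) x, convolution_def, heatPotential]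
  simp only [lsmul_apply]
  have hmp := measurePreserving_addLeft_prodCongr_subLeft (E := E) t x
  have h := hmp.integral_comp' (fun w : ℝ × E => heatKernelFwd ν ((t, x) - w) • Ψ (-w.1) w.2)
  rw [← h]
  congr 1
  funext w
  rw [addLeft_prodCongr_subLeft_apply]
  exact heatKernelFwd_smul_timeReflect_comp (ν := ν) (Ψ := Ψ) t x w

end ReflectPotential

/-! ### The representation of test fields -/

section Representation

variable {ν : ℝ} {Φ : ℝ → E → F}

/-- **The forward heat potential of `(∂ₜ - νΔ)Φ` is `Φ`** for every space–time test field `Φ`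
on `ℝ × E` and `ν > 0`:
`heatPotential ν (w ↦ ∂ₜΦ(w) - νΔΦ(w)) (z) = ∫∫ W₊(z - w) (∂ₜΦ - νΔΦ)(w) dw = Φ(z)`
(Duhamel's formula, Evans §2.3.1 Thm. 2; Lemarié-Rieusset 2016, Prop. 4.3 p. 74, read
forward). Proof: with `Θ(s) = Φ(-s)` one has `(∂ₜΦ - νΔΦ)(s) = -(∂ₜΘ + νΔΘ)(-s)`, the forward
potential of a reflected field is the backward Duhamel integral
(`heatPotential_timeReflect`), and `𝒰[∂ₜΘ] + ν𝒰[ΔΘ] = -Θ`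
(`heatDuhamelBack_backward_heat`). [cite: LemarieRieusset2016, Prop. 4.3 p. 74] -/
theorem IsSpaceTimeTestOn.heatPotential_heatOperator [CompleteSpace F]
    (hΦ : IsSpaceTimeTestOn (⊤ : Opens (ℝ × E)) Φ) (hν : 0 < ν) (z : ℝ × E) :
    heatPotential ν (fun w => timeDeriv Φ w.1 w.2 - ν • (Δ (Φ w.1)) w.2) z = Φ z.1 z.2 := by
  obtain ⟨t, x⟩ := z
  -- the reflected field and its derived fields
  set Θ : ℝ → E → F := fun s y => Φ (-s) y with hΘ_def
  have hΘ : IsSpaceTimeTestOn (⊤ : Opens (ℝ × E)) Θ := hΦ.timeReflect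
  have hΘ₁ : IsSpaceTimeTestOn (⊤ : Opens (ℝ × E)) (timeDeriv Θ) := hΘ.timeDeriv_top
  have hΘ₂ : IsSpaceTimeTestOn (⊤ : Opens (ℝ × E)) (fun s => Δ (Θ s)) := hΘ.laplacian_top
  -- `(∂ₜΦ - νΔΦ)(s, y) = -(∂ₜΘ)(-s, y) - ν Δ(Θ(-s))(y)`
  have hdata : (fun w : ℝ × E => timeDeriv Φ w.1 w.2 - ν • (Δ (Φ w.1)) w.2) =
      fun w : ℝ × E => -(timeDeriv Θ (-w.1) w.2) + -(ν • (fun s => Δ (Θ s)) (-w.1) w.2) := by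
    funext w
    have h1 : timeDeriv Θ (-w.1) w.2 = -timeDeriv Φ w.1 w.2 := by
      rw [hΘ_def, timeDeriv_timeReflect, neg_neg]
    have h2 : (fun s => Δ (Θ s)) (-w.1) = Δ (Φ w.1) := by
      simp only [hΘ_def, neg_neg]
    rw [h1, h2, neg_neg, sub_eq_add_neg]
  rw [hdata]
  -- split the potential
  have hi₁ : Integrable (fun w : ℝ × E => heatKernelFwd ν ((t, x) - w) • -(timeDeriv Θ (-w.1) w.2))
      (volume : Measure (ℝ × E)) := by
    simpa only [Pi.neg_def, smul_neg] using
      (hΘ₁.integrable_heatKernelFwd_smul_timeReflect hν t x).neg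
  have hi₂ : Integrable
      (fun w : ℝ × E => heatKernelFwd ν ((t, x) - w) • -(ν • (fun s => Δ (Θ s)) (-w.1) w.2))
      (volume : Measure (ℝ × E)) := by
    have h := ((hΘ₂.integrable_heatKernelFwd_smul_timeReflect hν t x).smul ν).neg
    refine h.congr (Eventually.of_forall fun w => ?_)
    simp only [Pi.smul_apply, Pi.neg_apply, smul_neg, smul_comm ν]
  rw [heatPotential_add hi₁ hi₂, heatPotential_neg, heatPotential_neg, heatPotential_smul,
    hΘ₁.heatPotential_timeReflect hν t x, hΘ₂.heatPotential_timeReflect hν t x]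
  -- the backward heat equation
  have hb := hΘ.heatDuhamelBack_backward_heat hν (-t) x
  have h3 : Θ (-t) x = Φ t x := by simp only [hΘ_def, neg_neg]
  rw [h3] at hb
  rw [← neg_add, hb, neg_neg]

/-- The same at a point written as a pair. [folklore] -/
theorem IsSpaceTimeTestOn.heatPotential_heatOperator_apply [CompleteSpace F]
    (hΦ : IsSpaceTimeTestOn (⊤ : Opens (ℝ × E)) Φ) (hν : 0 < ν) (t : ℝ) (x : E) :
    heatPotential ν (fun w => timeDeriv Φ w.1 w.2 - ν • (Δ (Φ w.1)) w.2) (t, x) = Φ t x :=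
  hΦ.heatPotential_heatOperator hν (t, x)

/-- **Functional form**: the forward heat potential of `uncurry ((∂ₜ - νΔ)Φ)` is `uncurry Φ`. [folklore] -/
theorem IsSpaceTimeTestOn.heatPotential_heatOperator_eq [CompleteSpace F]
    (hΦ : IsSpaceTimeTestOn (⊤ : Opens (ℝ × E)) Φ) (hν : 0 < ν) :
    heatPotential ν (fun w => timeDeriv Φ w.1 w.2 - ν • (Δ (Φ w.1)) w.2) = uncurry Φ := by
  funext z
  exact hΦ.heatPotential_heatOperator hν z

end Representation

end Literature.Analysis.FluidPDE
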